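import Mathlib
import Summits.ValiantsHypothesis.ValiantsHypothesis.Theses.UlrichPadded
import Summits.ValiantsHypothesis.ValiantsHypothesis.Theorems.UlrichPaddedNoTightInfinityRefutation
import Literature.Computability.AlgebraicComplexity.LandsbergRessayreNormalForm

/-!
# Sketch — first lemmas for the crux-idea cards on `UlrichPadded.NoTightInfinity`
(stmt-ValiantsHypothesis-5668), ideator 3, round 1.  Statements only (sorried); they must elaborate.
NOTE (2026-08-16): the crux was REFUTED in Lean while this seat was parked (`UlrichPaddedNoTightInfinity_refuted`,
Theorems/UlrichPaddedNoTightInfinityRefutation.lean, which re-declares the dropped constant `NoTightInfinity`; imported above).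
The lemmas below remain meaningful: V1–V5 (Kronecker/Krylov dictionary, confirmed numerically: Grenet (2,2,2), the refuter's and
this seat's tight witnesses (3,3,0)), G1–G3 (graded representations have corank_K L ≥ 2 — the refuter's repair attempt (2) is the
same theorem), R-lemmas (representation-scheme geometry: a second, dense tight witness on a ≈126-dimensional component of Rep₇(per₃)).
-/

noncomputable section

open MvPolynomial Matrix
open Literature.Computability.AlgebraicComplexity
open Summit.ValiantsHypothesis.ValiantsHypothesis.Theses.UlrichPadded (NoTightInfinity)

namespace Summit.ValiantsHypothesis.ValiantsHypothesis.Cruxes.NoTightInfinity.Sketch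

variable {n m : ℕ}

/-- the linear part `L` of an affine matrix (the item's `Matrix.of fun a b => homogeneousComponent 1 (A a b)`). -/
def linPart (A : Matrix (Fin m) (Fin m) (MvPolynomial (Fin n × Fin n) ℂ)) :
    Matrix (Fin m) (Fin m) (MvPolynomial (Fin n × Fin n) ℂ) :=
  Matrix.of fun a b => homogeneousComponent 1 (A a b)

/-- the constant part `A₀ = A(0)`. -/
def constPart (A : Matrix (Fin m) (Fin m) (MvPolynomial (Fin n × Fin n) ℂ)) : Matrix (Fin m) (Fin m) ℂ :=
  A.map constantCoeff

/-! ## Card `vertex-pencil-kronecker` -/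

/-- V1 (ray lemma). Along every ray of the cone `V(per_n)` the representation has corank EXACTLY one:
`rank A(t • p) = m - 1` for `per_n(p) = 0` and every `t : ℂ` (det vanishes by homogeneity; `≥ m - 1` is
von zur Gathen's everywhere-regularity, PROVED in tree as `vonzurGathen1987_perm_detRepr_rank_holds`).
Consequence: the vertex pencil `A₀ + τ L(p)` is a singular pencil with exactly ONE pair of Kronecker
blocks `L_ε ⊕ L_ηᵀ` and a regular part with no finite eigenvalue `τ ≠ ∞`... (see card). -/
theorem ray_rank (hn : 3 ≤ n) (A : Matrix (Fin m) (Fin m) (MvPolynomial (Fin n × Fin n) ℂ))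
    (hA : IsAffineDetRepr (perPoly (Fin n) ℂ) A) (p : Fin n × Fin n → ℂ)
    (hp : eval p (perPoly (Fin n) ℂ) = 0) (t : ℂ) :
    (A.map (eval (t • p))).rank + 1 = m := by
  sorry

/-- V2 (pointwise form of the crux). `NoTightInfinity` ↔ the linear part drops rank by at least two
at every point of the permanental hypersurface (Nullstellensatz for the principal prime `(per_n)`:
`per_n` irreducible, `ℂ` algebraically closed). -/
theorem noTightInfinity_iff_corank_two :
    NoTightInfinity ↔
      ∀ n : ℕ, 3 ≤ n → ∀ (m : ℕ) (A : Matrix (Fin m) (Fin m) (MvPolynomial (Fin n × Fin n) ℂ)),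
        IsAffineDetRepr (perPoly (Fin n) ℂ) A → ∀ p : Fin n × Fin n → ℂ,
          eval p (perPoly (Fin n) ℂ) = 0 → ((linPart A).map (eval p)).rank + 2 ≤ m := by
  sorry

/-- V3 (Schur normal form of a representation; `k = m - 1`). If the constant part is normalised to
`0 ⊕ 1` (always possible by constant row/column operations: `corank A₀ = 1` by V1 at `t = 0`), write the
linear part as `[[ℓ, bᵀ], [a, L']]`.  Then `ℓ = 0`, the low Markov parameters vanish and
`per_n = (-1)^(n-1) · bᵀ L'^(n-2) a` — every affine determinantal representation of `per_n` is a
width-`(m-1)` iterated matrix product with ONE repeated linear matrix (the "unit block" `L'`). -/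
theorem schur_normal_form (hn : 3 ≤ n) {k : ℕ} (ℓ : MvPolynomial (Fin n × Fin n) ℂ)
    (a b : Fin k → MvPolynomial (Fin n × Fin n) ℂ) (L' : Matrix (Fin k) (Fin k) (MvPolynomial (Fin n × Fin n) ℂ))
    (hℓ : ℓ.IsHomogeneous 1) (ha : ∀ i, (a i).IsHomogeneous 1) (hb : ∀ i, (b i).IsHomogeneous 1)
    (hL : ∀ i j, (L' i j).IsHomogeneous 1)
    (hdet : (Matrix.fromBlocks (Matrix.of fun (_ _ : Fin 1) => ℓ) (Matrix.of fun (_ : Fin 1) j => b j)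
        (Matrix.of fun i (_ : Fin 1) => a i) (1 + L')).det = perPoly (Fin n) ℂ) :
    ℓ = 0 ∧ (∀ j, j + 2 < n → b ⬝ᵥ (L' ^ j).mulVec a = 0) ∧
      b ⬝ᵥ (L' ^ (n - 2)).mulVec a = (-1) ^ (n - 1) • perPoly (Fin n) ℂ := by
  sorry

/-- V4 (the live sub-case, planner's why-might-fail made exact). In Schur normal form, if the unit block
has `per_n ∤ det L'` then the representation is TIGHT: the `(0,0)`-cofactor of the linear part is `det L'`
itself, so `NoTightInfinity` fails for it.  Hence `NoTightInfinity → per_n ∣ det L'` for every normalised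
representation ("NTI-a", the first rung to attack or to refute). -/
theorem tight_of_not_dvd_det_unitBlock {k : ℕ}
    (a b : Fin k → MvPolynomial (Fin n × Fin n) ℂ) (L' : Matrix (Fin k) (Fin k) (MvPolynomial (Fin n × Fin n) ℂ))
    (ha : ∀ i, (a i).IsHomogeneous 1) (hb : ∀ i, (b i).IsHomogeneous 1) (hL : ∀ i j, (L' i j).IsHomogeneous 1)
    (h : ¬ perPoly (Fin n) ℂ ∣ L'.det) :
    (Matrix.fromBlocks (0 : Matrix (Fin 1) (Fin 1) _) (Matrix.of fun (_ : Fin 1) j => b j)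
        (Matrix.of fun i (_ : Fin 1) => a i) L').adjugate (Sum.inl 0) (Sum.inl 0)
      ∉ Ideal.span {perPoly (Fin n) ℂ} := by
  sorry

/-- Krylov (reachable) dimension of a pair `(F, a)`. -/
def krylovDim {k : ℕ} (F : Matrix (Fin k) (Fin k) ℂ) (a : Fin k → ℂ) : ℕ :=
  Module.finrank ℂ (Submodule.span ℂ (Set.range fun j : ℕ => (F ^ j).mulVec a))

/-- TRANSFER `C⁺` (Krylov non-complementarity), for one normalised representation `[[0,bᵀ],[a,1+L']]`:
at every point `p` of `V(per_n)` the reachable space of `(L'(p), a(p))` and the observable space of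
`(L'(p)ᵀ, b(p))` have dimensions summing to at most `m - 2 = k - 1`.  (They always sum to `≤ k`, because all
Markov parameters `bᵀL'ʲa` are multiples of `per_n`; the Kronecker minimal indices of the vertex pencil are
EXACTLY these two dimensions, so this is `NoTightInfinity` for that representation.) -/
def KrylovNonComplementary (n k : ℕ) (a b : Fin k → MvPolynomial (Fin n × Fin n) ℂ)
    (L' : Matrix (Fin k) (Fin k) (MvPolynomial (Fin n × Fin n) ℂ)) : Prop :=
  ∀ p : Fin n × Fin n → ℂ, eval p (perPoly (Fin n) ℂ) = 0 →
    krylovDim (L'.map (eval p)) (fun i => eval p (a i)) +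
      krylovDim ((L'.map (eval p)).transpose) (fun i => eval p (b i)) + 1 ≤ k

/-- V5 (the transfer is exact): for a normalised representation, divisibility of all submaximal minors of
the linear part by `per_n` is equivalent to Krylov non-complementarity on `V(per_n)`. -/
theorem adjugate_dvd_iff_krylov (hn : 3 ≤ n) {k : ℕ}
    (a b : Fin k → MvPolynomial (Fin n × Fin n) ℂ) (L' : Matrix (Fin k) (Fin k) (MvPolynomial (Fin n × Fin n) ℂ))
    (ha : ∀ i, (a i).IsHomogeneous 1) (hb : ∀ i, (b i).IsHomogeneous 1) (hL : ∀ i j, (L' i j).IsHomogeneous 1)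
    (hdet : (Matrix.fromBlocks (0 : Matrix (Fin 1) (Fin 1) _) (Matrix.of fun (_ : Fin 1) j => b j)
        (Matrix.of fun i (_ : Fin 1) => a i) (1 + L')).det = perPoly (Fin n) ℂ) :
    (∀ i j, (Matrix.fromBlocks (0 : Matrix (Fin 1) (Fin 1) _) (Matrix.of fun (_ : Fin 1) j => b j)
        (Matrix.of fun i (_ : Fin 1) => a i) L').adjugate i j ∈ Ideal.span {perPoly (Fin n) ℂ}) ↔
      KrylovNonComplementary n k a b L' := by
  sorry

/-! ## Card `rep-scheme-compression` -/

/-- First-order rigidity of "corank ≥ 2 at infinity" at a representation `A`: every Zariski tangent vector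
`Ȧ` of the representation scheme `{det = per_n, entries affine}` (i.e. `tr(adj A · Ȧ) = 0`, `Ȧ` affine) has
vanishing compression `yᵀ L̇(p) z = 0` between the left and right kernels of `L(p)`, at every `p ∈ V(per_n)`. -/
def CompressionRigidAt (A : Matrix (Fin m) (Fin m) (MvPolynomial (Fin n × Fin n) ℂ)) : Prop :=
  ∀ Adot : Matrix (Fin m) (Fin m) (MvPolynomial (Fin n × Fin n) ℂ), (∀ i j, (Adot i j).totalDegree ≤ 1) →
    (A.adjugate * Adot).trace = 0 →
    ∀ p : Fin n × Fin n → ℂ, eval p (perPoly (Fin n) ℂ) = 0 →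
      ((linPart A).map (eval p)).rank + 2 = m →   -- only at points where corank L(p) is EXACTLY 2 (j005012: fails at corank-3 points)
      ∀ y z : Fin m → ℂ, Matrix.vecMul y ((linPart A).map (eval p)) = 0 →
        ((linPart A).map (eval p)).mulVec z = 0 →
          y ⬝ᵥ ((linPart Adot).map (eval p)).mulVec z = 0

/-- Grenet's `7 × 7` representation of `per₃` (rows/columns `s, u₀, u₁, u₂, v₀, v₁, v₂`), as in
`Theorems/GrenetRigidityOptimalUniqueRefutation.lean`. -/
def grenet7 : Matrix (Fin 7) (Fin 7) (MvPolynomial (Fin 3 × Fin 3) ℂ) :=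
  !![0, X (0,0), X (1,0), X (2,0), 0, 0, 0;
     0, 1, 0, 0, 0, X (2,1), X (1,1);
     0, 0, 1, 0, X (2,1), 0, X (0,1);
     0, 0, 0, 1, X (1,1), X (0,1), 0;
     X (0,2), 0, 0, 0, 1, 0, 0;
     X (1,2), 0, 0, 0, 0, 1, 0;
     X (2,2), 0, 0, 0, 0, 0, 1]

/-- R1 (decided by exact linear algebra off-box, kit job j005012: tangent space of dimension 141, the
compression map vanishes at generic points of `V(per₃)`): corank-2-at-infinity is first-order rigid at
Grenet's point of `Rep₇(per₃)`. -/
theorem grenet7_compressionRigid : CompressionRigidAt grenet7 := by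
  sorry

/-- R2 (the smallest instance of the crux, decidable in principle: `dc(per₃) = 7` is PROVED in tree,
`alperBogartVelasco2017_cor_1_4_holds`): `NoTightInfinity` at `n = 3`, `m = 7`. -/
theorem noTightInfinity_three_seven (A : Matrix (Fin 7) (Fin 7) (MvPolynomial (Fin 3 × Fin 3) ℂ))
    (hA : IsAffineDetRepr (perPoly (Fin 3) ℂ) A) (i j : Fin 7) :
    (linPart A).adjugate i j ∈ Ideal.span {perPoly (Fin 3) ℂ} := by
  sorry

/-- R3 (the negative target at the smallest instance; what a certified tight witness would prove). -/
theorem not_noTightInfinity_three_seven_of_witness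
    (A : Matrix (Fin 7) (Fin 7) (MvPolynomial (Fin 3 × Fin 3) ℂ)) (hA : IsAffineDetRepr (perPoly (Fin 3) ℂ) A)
    (p : Fin 3 × Fin 3 → ℂ) (hp : eval p (perPoly (Fin 3) ℂ) = 0) (h6 : 6 ≤ ((linPart A).map (eval p)).rank) :
    ¬ NoTightInfinity := by
  sorry

/-! ## Card `symmetric-parity` remark (inside card 1): for a SYMMETRIC representation the two minimal
indices agree, so the regular part has size `m - 1 - 2ε ≡ m - 1 (mod 2)`; even size ⇒ non-tight. -/
theorem noTight_of_symmetric_even (hn : 3 ≤ n) (hm : Even m)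
    (A : Matrix (Fin m) (Fin m) (MvPolynomial (Fin n × Fin n) ℂ)) (hA : IsAffineDetRepr (perPoly (Fin n) ℂ) A)
    (hsym : A.transpose = A) (i j : Fin m) :
    (linPart A).adjugate i j ∈ Ideal.span {perPoly (Fin n) ℂ} := by
  sorry


/-! ## Card `homothety-lift-grading` -/

/-- constant gauge `P · A · Q`. -/
def cgauge (P Q : Matrix (Fin m) (Fin m) ℂ) (A : Matrix (Fin m) (Fin m) (MvPolynomial (Fin n × Fin n) ℂ)) :
    Matrix (Fin m) (Fin m) (MvPolynomial (Fin n × Fin n) ℂ) :=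
  P.map (algebraMap ℂ (MvPolynomial (Fin n × Fin n) ℂ)) * A * Q.map (algebraMap ℂ (MvPolynomial (Fin n × Fin n) ℂ))

/-- A representation is GRADABLE (homothety-equivariant up to constant gauge) if, after a constant change of bases,
integer row/column weights put the constant part in weight `0` and the linear part in weight `1`
(equivalently: `A(t • x) = ρ₁(t) · A(x) · ρ₂(t)` for one-parameter subgroups `ρ₁, ρ₂`). Layered ABP / formula
representations, Grenet's matrix and the GrenetRigidity twist are gradable. -/
def IsGradable (A : Matrix (Fin m) (Fin m) (MvPolynomial (Fin n × Fin n) ℂ)) : Prop :=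
  ∃ (P Q : Matrix (Fin m) (Fin m) ℂ) (α β : Fin m → ℤ), IsUnit P.det ∧ IsUnit Q.det ∧
    (∀ i j, constantCoeff (cgauge P Q A i j) ≠ 0 → α i + β j = 0) ∧
    (∀ i j, homogeneousComponent 1 (cgauge P Q A i j) ≠ 0 → α i + β j = 1)

/-- `L`-GRADABLE: weights may be merely non-positive on the constant part (the Białynicki-Birula limit `t → 0` then
exists, is a gradable representation of `per_n` when the weights sum to `n`, and has the SAME linear part). -/
def IsLGradable (A : Matrix (Fin m) (Fin m) (MvPolynomial (Fin n × Fin n) ℂ)) : Prop :=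
  ∃ (P Q : Matrix (Fin m) (Fin m) ℂ) (α β : Fin m → ℤ), IsUnit P.det ∧ IsUnit Q.det ∧
    (∀ i j, constantCoeff (cgauge P Q A i j) ≠ 0 → α i + β j ≤ 0) ∧
    (∀ i j, homogeneousComponent 1 (cgauge P Q A i j) ≠ 0 → α i + β j = 1) ∧
    ∑ i, (α i + β i) = n

/-- G1 (Fano-type bound from von zur Gathen's codimension-5 theorem, `vonzurGathen1987_singPerm_height_holds`):
`per_n` (n ≥ 3) is not in any ideal generated by two linear forms — else `Sing V(per_n) ⊇ V(ℓ₁, ℓ₂, g₁, g₂)` would have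
codimension ≤ 4. -/
theorem perPoly_not_mem_span_pair (hn : 3 ≤ n) (ℓ₁ ℓ₂ : MvPolynomial (Fin n × Fin n) ℂ)
    (h₁ : ℓ₁.IsHomogeneous 1) (h₂ : ℓ₂.IsHomogeneous 1) :
    perPoly (Fin n) ℂ ∉ Ideal.span ({ℓ₁, ℓ₂} : Set (MvPolynomial (Fin n × Fin n) ℂ)) := by
  sorry

/-- G2 (graded representations are deep in Case I): for a gradable representation of `per_n`, `n ≥ 3`, the linear
part has corank ≥ 2 identically (level-profile count: corank L ≥ (max level width) − 1 ≥ ρ_b − 1 ≥ 2 by G1), hence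
all its submaximal minors vanish — NoTightInfinity holds for it with `adj L = 0`. -/
theorem adjugate_linPart_eq_zero_of_gradable (hn : 3 ≤ n) (A : Matrix (Fin m) (Fin m) (MvPolynomial (Fin n × Fin n) ℂ))
    (hA : IsAffineDetRepr (perPoly (Fin n) ℂ) A) (hg : IsGradable A) : (linPart A).adjugate = 0 := by
  sorry

/-- G3 (Białynicki-Birula bridge): the same conclusion for `L`-gradable representations (the limit representation is
gradable with the same linear part). -/
theorem adjugate_linPart_eq_zero_of_LGradable (hn : 3 ≤ n) (A : Matrix (Fin m) (Fin m) (MvPolynomial (Fin n × Fin n) ℂ))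
    (hA : IsAffineDetRepr (perPoly (Fin n) ℂ) A) (hg : IsLGradable A) : (linPart A).adjugate = 0 := by
  sorry

/-- G4 (what the card reduces the crux to; almost surely FALSE if the numerical tight candidate is real — then it is the
exact description of the regime boundary): every affine representation of `per_n` is `L`-gradable. -/
def AllLGradable : Prop :=
  ∀ n : ℕ, 3 ≤ n → ∀ (m : ℕ) (A : Matrix (Fin m) (Fin m) (MvPolynomial (Fin n × Fin n) ℂ)),
    IsAffineDetRepr (perPoly (Fin n) ℂ) A → IsLGradable A

theorem noTightInfinity_of_allLGradable (h : AllLGradable)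
    (hG3 : ∀ n m, 3 ≤ n → ∀ A : Matrix (Fin m) (Fin m) (MvPolynomial (Fin n × Fin n) ℂ),
      IsAffineDetRepr (perPoly (Fin n) ℂ) A → IsLGradable A → (linPart A).adjugate = 0) :
    NoTightInfinity := by
  intro n hn m A hA i j
  have h0 := hG3 n m hn A hA (h n hn m A hA)
  have : (linPart A).adjugate i j = 0 := by rw [h0]; rfl
  show (Matrix.of fun a b => homogeneousComponent 1 (A a b)).adjugate i j ∈ _
  have hl : (Matrix.of fun a b => homogeneousComponent 1 (A a b)) = linPart A := rfl
  rw [hl, this]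
  exact Ideal.zero_mem _

end Summit.ValiantsHypothesis.ValiantsHypothesis.Cruxes.NoTightInfinity.Sketch
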